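import Literature.Analysis.PDE.DbarWeakUniqueContinuation
import Mathlib.Analysis.Calculus.FDeriv.Mul
import Mathlib.Analysis.Calculus.ContDiff.Operations
import Mathlib.Analysis.Normed.Ring.Units
import HarnessLib

/-!
# Unique continuation from an open set for `J`-holomorphic maps, flat version

Let `E` be a real inner product space (complete), `U` a neighbourhood of `z₁ ∈ ℂ`,
`Jt : ℂ → (E →L[ℝ] E)` of class `C²` on `U` with `(Jt z)² = -1`, and `u : ℂ → E` of class `C²`
on `U` with the `J`-holomorphicity equation written in a chart,

  `∂_y u (z) = Jt z (∂ₓ u (z))`   (`∂ₓ = fderiv ℝ u z 1`, `∂_y = fderiv ℝ u z I`).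

If `u ≡ c` on an open set `A` with `z₁ ∈ closure A`, then `u ≡ c` near `z₁`
(`eventuallyEq_const_of_jHolomorphicFlat`). Proof (Carleman 1939 / McDuff 1991, Lemma 2.3, via
the weak unique continuation theorem `dbar_weak_unique_continuation` of
`Literature/Analysis/PDE/DbarWeakUniqueContinuation.lean`): with `J₀ = Jt z₁` and the frame
`Φ z = ½ (1 - Jt z ∘ J₀)` one has `Jt z ∘ Φ z = Φ z ∘ J₀` and `Φ z₁ = 1`, so `Φ z` is
invertible near `z₁` with `C²` inverse `Ψ z`; then `w = Ψ (u - c)` satisfies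
`∂_y w - J₀ ∂ₓ w = Ψ (Jt (∂ₓΦ) w - (∂_yΦ) w)`, whence `‖∂ₓ w + J₀ ∂_y w‖ ≤ C ‖w‖` on a closed
disc around `z₁`, and `w = 0` near a point of `A` close to `z₁`.

This is the analytic core of McDuff's Lemma 2.3 (JDG 34 (1991), p. 147) in the weak form needed
for `Literature.Geometry.Symplectic.jHolomorphic_uniqueContinuation_const`; McDuff quotes
Aronszajn's theorem, we use Carleman's first-order method instead.
-/

noncomputable section

open Complex Function Metric Filter Set
open scoped Topology

namespace Literature.Geometry.Symplectic.JHolomorphicUCP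

variable {E : Type*} [NormedAddCommGroup E] [InnerProductSpace ℝ E]

/-- The frame `Φ = ½(1 - J J₀)` intertwines two complex structures: `J Φ = Φ J₀`. [folklore] -/
theorem frame_intertwines (J J₀ : E →L[ℝ] E) (hJ : ∀ v, J (J v) = -v)
    (hJ₀ : ∀ v, J₀ (J₀ v) = -v) (x : E) :
    J (((1 / 2 : ℝ) • (1 - J * J₀)) x) = ((1 / 2 : ℝ) • (1 - J * J₀)) (J₀ x) := by
  show J ((1 / 2 : ℝ) • (x - J (J₀ x))) = (1 / 2 : ℝ) • (J₀ x - J (J₀ (J₀ x)))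
  rw [map_smul, map_sub, hJ, hJ₀, map_neg]
  congr 1
  abel

/-- The frame at the base point is the identity: `½(1 - J₀ J₀) = 1`. [folklore] -/
theorem frame_self (J₀ : E →L[ℝ] E) (hJ₀ : ∀ v, J₀ (J₀ v) = -v) :
    ((1 / 2 : ℝ) • (1 - J₀ * J₀) : E →L[ℝ] E) = 1 := by
  ext x
  show (1 / 2 : ℝ) • (x - J₀ (J₀ x)) = x
  rw [hJ₀, sub_neg_eq_add, ← two_smul ℝ x, smul_smul]
  norm_num

variable [CompleteSpace E]

/-- **Unique continuation from an open set for `J`-holomorphic maps (flat form).**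
See the module docstring. [cite: McDuff1991LocalBehaviour, Lemma 2.3] -/
theorem eventuallyEq_const_of_jHolomorphicFlat {u : ℂ → E} {Jt : ℂ → E →L[ℝ] E} {z₁ : ℂ}
    {c : E} {U A : Set ℂ} (hU : U ∈ 𝓝 z₁) (hu : ContDiffOn ℝ 2 u U)
    (hJt : ContDiffOn ℝ 2 Jt U) (hJ2 : ∀ z ∈ U, ∀ v, Jt z (Jt z v) = -v)
    (hhol : ∀ z ∈ U, fderiv ℝ u z I = Jt z (fderiv ℝ u z 1))
    (hA : IsOpen A) (hAu : ∀ z ∈ A, u z = c) (hz₁ : z₁ ∈ closure A) :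
    ∀ᶠ z in 𝓝 z₁, u z = c := by
  -- an open neighbourhood `U' ⊆ U` of `z₁`
  obtain ⟨U', hU'U, hU'open, hz₁U'⟩ := _root_.mem_nhds_iff.mp hU
  have hz₁U : z₁ ∈ U := hU'U hz₁U'
  -- the base complex structure and the frame
  set J₀ : E →L[ℝ] E := Jt z₁ with hJ₀
  have hJ₀2 : ∀ v, J₀ (J₀ v) = -v := hJ2 z₁ hz₁U
  obtain ⟨Φ, hΦ_def⟩ : ∃ Φ : ℂ → E →L[ℝ] E, Φ = fun z => (1 / 2 : ℝ) • (1 - Jt z * J₀) :=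
    ⟨_, rfl⟩
  have hΦU : ContDiffOn ℝ 2 Φ U := by
    rw [hΦ_def]
    exact (contDiffOn_const.sub (hJt.mul contDiffOn_const)).const_smul (1 / 2 : ℝ)
  have hΦz₁ : Φ z₁ = 1 := by rw [hΦ_def]; exact frame_self J₀ hJ₀2
  have hcomm : ∀ z ∈ U, ∀ x, Jt z (Φ z x) = Φ z (J₀ x) := fun z hz x => by
    rw [hΦ_def]; exact frame_intertwines (Jt z) J₀ (hJ2 z hz) hJ₀2 x
  -- the open set `V ⊆ U'` where `Φ` is invertible
  set V : Set ℂ := U' ∩ Φ ⁻¹' {x | IsUnit x} with hV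
  have hΦcontU' : ContinuousOn Φ U' := (hΦU.mono hU'U).continuousOn
  have hVopen : IsOpen V := hΦcontU'.isOpen_inter_preimage hU'open Units.isOpen
  have hz₁V : z₁ ∈ V := ⟨hz₁U', by simp [hΦz₁]⟩
  have hVU : V ⊆ U := fun z hz => hU'U hz.1
  -- the inverse frame `Ψ`
  obtain ⟨Ψ, hΨ_def⟩ : ∃ Ψ : ℂ → E →L[ℝ] E, Ψ = fun z => Ring.inverse (Φ z) := ⟨_, rfl⟩
  have hΨΦ : ∀ z ∈ V, ∀ x, Ψ z (Φ z x) = x := by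
    intro z hz x
    rw [hΨ_def]
    show (Ring.inverse (Φ z) * Φ z) x = x
    rw [Ring.inverse_mul_cancel _ hz.2]
    rfl
  have hΦΨ : ∀ z ∈ V, ∀ x, Φ z (Ψ z x) = x := by
    intro z hz x
    rw [hΨ_def]
    show (Φ z * Ring.inverse (Φ z)) x = x
    rw [Ring.mul_inverse_cancel _ hz.2]
    rfl
  have hΨV : ContDiffOn ℝ 2 Ψ V := by
    intro z hz
    obtain ⟨uΦ, huΦ⟩ := hz.2
    have h1 : ContDiffAt ℝ 2 Ring.inverse (Φ z) := by
      rw [← huΦ]; exact contDiffAt_ringInverse ℝ uΦ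
    rw [hΨ_def]
    exact h1.comp_contDiffWithinAt z ((hΦU z (hVU hz)).mono hVU)
  -- a ball `ball z₁ R₀ ⊆ V` and the working radius `R = R₀ / 2`
  obtain ⟨R₀, hR₀, hballV⟩ := Metric.isOpen_iff.mp hVopen z₁ hz₁V
  set R : ℝ := R₀ / 2 with hR
  have hRpos : 0 < R := by positivity
  have hcbV : closedBall z₁ R ⊆ V := fun z hz =>
    hballV (mem_ball.mpr (lt_of_le_of_lt (mem_closedBall.mp hz) (by rw [hR]; linarith)))
  have hbV : ball z₁ R ⊆ V := ball_subset_closedBall.trans hcbV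
  -- the function `w = Ψ (u - c)`
  obtain ⟨w, hw_def⟩ : ∃ w : ℂ → E, w = fun z => Ψ z (u z - c) := ⟨_, rfl⟩
  have hwV : ContDiffOn ℝ 2 w V := by
    rw [hw_def]; exact hΨV.clm_apply ((hu.mono hVU).sub contDiffOn_const)
  have huw : ∀ z ∈ V, u z - c = Φ z (w z) := fun z hz => by rw [hw_def, hΦΨ z hz]
  -- derivatives on `V`
  have hVnhds : ∀ z ∈ V, V ∈ 𝓝 z := fun z hz => hVopen.mem_nhds hz
  have hud : ∀ z ∈ V, HasFDerivAt u (fderiv ℝ u z) z := fun z hz =>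
    (((hu.mono hVU).contDiffAt (hVnhds z hz)).differentiableAt (by norm_num)).hasFDerivAt
  have hwd : ∀ z ∈ V, HasFDerivAt w (fderiv ℝ w z) z := fun z hz =>
    ((hwV.contDiffAt (hVnhds z hz)).differentiableAt (by norm_num)).hasFDerivAt
  have hΦd : ∀ z ∈ V, HasFDerivAt Φ (fderiv ℝ Φ z) z := fun z hz =>
    (((hΦU.mono hVU).contDiffAt (hVnhds z hz)).differentiableAt (by norm_num)).hasFDerivAt
  have hDu : ∀ z ∈ V, ∀ ζ, fderiv ℝ u z ζ = Φ z (fderiv ℝ w z ζ) + fderiv ℝ Φ z ζ (w z) := by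
    intro z hz ζ
    have h1 : HasFDerivAt (fun y => u y - c) (fderiv ℝ u z) z := (hud z hz).sub_const c
    have h2 : HasFDerivAt (fun y => Φ y (w y))
        ((Φ z).comp (fderiv ℝ w z) + (fderiv ℝ Φ z).flip (w z)) z :=
      (hΦd z hz).clm_apply (hwd z hz)
    have heq : (fun y => u y - c) =ᶠ[𝓝 z] fun y => Φ y (w y) := by
      filter_upwards [hVnhds z hz] with y hy using huw y hy
    have h3 := h1.unique (h2.congr_of_eventuallyEq heq)
    rw [h3]
    simp
  -- the key identity `∂_y w - J₀ ∂ₓ w = Ψ (Jt (∂ₓΦ w) - ∂_yΦ w)` on `V`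
  have hkey : ∀ z ∈ V, fderiv ℝ w z I - J₀ (fderiv ℝ w z 1)
      = Ψ z (Jt z (fderiv ℝ Φ z 1 (w z)) - fderiv ℝ Φ z I (w z)) := by
    intro z hz
    have hzU : z ∈ U := hVU hz
    have h := hhol z hzU
    rw [hDu z hz I, hDu z hz 1, map_add, hcomm z hzU] at h
    -- `h : Φ (Dw I) + DΦ I w = Φ (J₀ (Dw 1)) + Jt (DΦ 1 w)`
    have h' : Φ z (fderiv ℝ w z I - J₀ (fderiv ℝ w z 1))
        = Jt z (fderiv ℝ Φ z 1 (w z)) - fderiv ℝ Φ z I (w z) := by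
      rw [map_sub]
      exact sub_eq_sub_iff_add_eq_add.mpr (by rw [h]; abel)
    calc fderiv ℝ w z I - J₀ (fderiv ℝ w z 1)
        = Ψ z (Φ z (fderiv ℝ w z I - J₀ (fderiv ℝ w z 1))) := (hΨΦ z hz _).symm
      _ = _ := by rw [h']
  -- sup bounds on the closed disc `closedBall z₁ R ⊆ V`
  have hK : IsCompact (closedBall z₁ R) := isCompact_closedBall _ _
  have hΨcont : ContinuousOn Ψ (closedBall z₁ R) := hΨV.continuousOn.mono hcbV
  have hJcont : ContinuousOn Jt (closedBall z₁ R) := hJt.continuousOn.mono (hcbV.trans hVU)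
  have hDΦcont : ContinuousOn (fderiv ℝ Φ) (closedBall z₁ R) :=
    ((hΦU.mono hVU).continuousOn_fderiv_of_isOpen hVopen (by norm_num)).mono hcbV
  obtain ⟨MΨ, hMΨ⟩ := hK.exists_bound_of_continuousOn hΨcont
  obtain ⟨MJ, hMJ⟩ := hK.exists_bound_of_continuousOn hJcont
  obtain ⟨MΦ, hMΦ⟩ := hK.exists_bound_of_continuousOn (f := fderiv ℝ Φ) hDΦcont
  have hz₁K : z₁ ∈ closedBall z₁ R := mem_closedBall_self hRpos.le
  have hMΨnn : 0 ≤ MΨ := (norm_nonneg _).trans (hMΨ z₁ hz₁K)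
  have hMJnn : 0 ≤ MJ := (norm_nonneg _).trans (hMJ z₁ hz₁K)
  have hMΦnn : 0 ≤ MΦ := (norm_nonneg _).trans (hMΦ z₁ hz₁K)
  obtain ⟨C, hC⟩ : ∃ C : ℝ, C = ‖J₀‖ * MΨ * (MJ * MΦ + MΦ) := ⟨_, rfl⟩
  have hineq : ∀ z ∈ ball z₁ R, ‖fderiv ℝ w z 1 + J₀ (fderiv ℝ w z I)‖ ≤ C * ‖w z‖ := by
    intro z hz
    have hzK : z ∈ closedBall z₁ R := ball_subset_closedBall hz
    have hzV : z ∈ V := hbV hz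
    have hid : fderiv ℝ w z 1 + J₀ (fderiv ℝ w z I)
        = J₀ (fderiv ℝ w z I - J₀ (fderiv ℝ w z 1)) := by
      rw [map_sub, hJ₀2]; abel
    rw [hid, hkey z hzV]
    have hΦe : ∀ e : ℂ, ‖e‖ = 1 → ‖fderiv ℝ Φ z e (w z)‖ ≤ MΦ * ‖w z‖ := by
      intro e he
      calc ‖fderiv ℝ Φ z e (w z)‖ ≤ ‖fderiv ℝ Φ z e‖ * ‖w z‖ :=
            ContinuousLinearMap.le_opNorm _ _
        _ ≤ (‖fderiv ℝ Φ z‖ * ‖e‖) * ‖w z‖ := by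
            gcongr; exact ContinuousLinearMap.le_opNorm _ _
        _ ≤ MΦ * ‖w z‖ := by rw [he, mul_one]; gcongr; exact hMΦ z hzK
    have h1 := hΦe 1 norm_one
    have h2 := hΦe I Complex.norm_I
    have h3 : ‖Jt z (fderiv ℝ Φ z 1 (w z))‖ ≤ MJ * (MΦ * ‖w z‖) :=
      (ContinuousLinearMap.le_opNorm _ _).trans
        (mul_le_mul (hMJ z hzK) h1 (norm_nonneg _) hMJnn)
    have h4 : ‖Jt z (fderiv ℝ Φ z 1 (w z)) - fderiv ℝ Φ z I (w z)‖
        ≤ (MJ * MΦ + MΦ) * ‖w z‖ := by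
      calc ‖Jt z (fderiv ℝ Φ z 1 (w z)) - fderiv ℝ Φ z I (w z)‖
          ≤ ‖Jt z (fderiv ℝ Φ z 1 (w z))‖ + ‖fderiv ℝ Φ z I (w z)‖ := norm_sub_le _ _
        _ ≤ MJ * (MΦ * ‖w z‖) + MΦ * ‖w z‖ := add_le_add h3 h2
        _ = (MJ * MΦ + MΦ) * ‖w z‖ := by ring
    have h5 : ‖Ψ z (Jt z (fderiv ℝ Φ z 1 (w z)) - fderiv ℝ Φ z I (w z))‖
        ≤ MΨ * ((MJ * MΦ + MΦ) * ‖w z‖) :=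
      (ContinuousLinearMap.le_opNorm _ _).trans
        (mul_le_mul (hMΨ z hzK) h4 (norm_nonneg _) hMΨnn)
    calc ‖J₀ (Ψ z (Jt z (fderiv ℝ Φ z 1 (w z)) - fderiv ℝ Φ z I (w z)))‖
        ≤ ‖J₀‖ * ‖Ψ z (Jt z (fderiv ℝ Φ z 1 (w z)) - fderiv ℝ Φ z I (w z))‖ :=
          ContinuousLinearMap.le_opNorm _ _
      _ ≤ ‖J₀‖ * (MΨ * ((MJ * MΦ + MΦ) * ‖w z‖)) :=
          mul_le_mul_of_nonneg_left h5 (norm_nonneg _)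
      _ = C * ‖w z‖ := by rw [hC]; ring
  -- a point of `A` close to `z₁`, near which `w` vanishes
  obtain ⟨a, haA, ha⟩ : ∃ a ∈ A, dist z₁ a < R / 4 :=
    Metric.mem_closure_iff.mp hz₁ (R / 4) (by positivity)
  have hwa : ∀ᶠ z in 𝓝 a, w z = 0 := by
    have haball : a ∈ ball z₁ R := by rw [mem_ball, dist_comm]; linarith
    have : A ∩ ball z₁ R ∈ 𝓝 a := (hA.inter isOpen_ball).mem_nhds ⟨haA, haball⟩
    filter_upwards [this] with z hz
    rw [hw_def]
    simp [hAu z hz.1]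
  -- weak unique continuation for `w`, then back to `u`
  have hmain := Literature.Analysis.PDE.DbarCarleman.dbar_weak_unique_continuation J₀ hJ₀2
    (hwV.mono hbV) hineq (by rwa [dist_comm]) hwa
  filter_upwards [hmain, hVopen.mem_nhds hz₁V] with z hz hzV
  have h := huw z hzV
  rwa [hz, map_zero, sub_eq_zero] at h

end Literature.Geometry.Symplectic.JHolomorphicUCP
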